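import Summits.RiemannHypothesis.RiemannHypothesis.Theorems.SpectralTraceHeckeSurrogateDefs
import Summits.RiemannHypothesis.RiemannHypothesis.Theorems.SpectralTraceWindowTracePrime2StubXi2Surrogate
import Mathlib.Analysis.Complex.Liouville
import Mathlib.Analysis.Complex.LocallyUniformLimit
import Mathlib.Analysis.SpecialFunctions.Log.Base
import HarnessLib

/-!
# Right half-plane control of a surrogate — stub `stub_logDerivDiff`

Route `RiemannHypothesis/SpectralTrace`, crux `WindowTracePrime2` (stmt-RiemannHypothesis-11196),
line `hecke-cusp-perturbation-surrogate`, registered stub **A**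
`stub_logDerivDiff : ∀ E, IsSurrogate E → RightHalfPlaneControl E`
(skeleton `Cruxes/WindowTracePrime2/Lines/hecke_cusp_perturbation_surrogate.lean`; vocabulary
`Theorems/SpectralTraceHeckeSurrogateDefs.lean`; the instance `stub_xi2Surrogate : IsSurrogate xi2`
from `Theorems/SpectralTraceWindowTracePrime2StubXi2Surrogate.lean`).

The proof uses no arithmetic: only two general Dirichlet series `L_E = Σ c_k ν_k^{-s}` and
`L_ξ = Σ c'_k ν'_k^{-s}` with the SAME first two terms `1 + 2^{-s}` and all other frequencies `≥ 3`.
* `dirichlet_control`: from `IsSurrogate E` — `L` is holomorphic on the open half-plane of absolute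
  convergence (Weierstrass: locally uniform limit), `E = s(s-1)Γ_ℝ(s) L`, `L = 1 + 2^{-s} + A` with
  `‖A(s)‖ ≤ K 3^{-Re s}` (`ν^{-σ} = ν^{-σ₀} ν^{-(σ-σ₀)} ≤ ν^{-σ₀} 3^{-(σ - σ₀)}` for `ν ≥ 3`), and
  `‖L(s)‖ ≤ M`.
* Beyond `σ₁ := σ* + 2 + log₃(4K+1)`: `‖2^{-s}‖ ≤ 1/4`, `‖A‖ ≤ 1/4`, so `‖L‖ ≥ 1/2` and
  `‖s(s-1)Γ_ℝ(s)‖ ≤ 2‖E(s)‖` (part (i)).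
* Part (ii): `E/ξ₂ = L_E/L_ξ` near `s` (the factor `s(s-1)Γ_ℝ(s) ≠ 0` cancels), so
  `E'/E - ξ₂'/ξ₂ = L_E'/L_E - L_ξ'/L_ξ = D'/L_E + L_ξ'(L_ξ - L_E)/(L_E L_ξ)` with `D = L_E - L_ξ = A_E - A_ξ`
  (the frequency-`1` and frequency-`2` terms CANCEL — window-invisibility), `‖D‖ ≤ K 3^{-σ}`, and by
  Cauchy's estimate on the unit circle `‖D'(s)‖ ≤ 3K 3^{-σ}`, `‖L_ξ'(s)‖ ≤ M`; whence the bound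
  `(6 + 4M) K · 3^{-Re s}`.

References: E. Hecke, *Über die Bestimmung Dirichletscher Reihen durch ihre Funktionalgleichung*,
Math. Ann. 112 (1936), §2 [Hecke1936]; E. C. Titchmarsh, *The theory of the Riemann zeta-function*
(1986), §9.2 [Titchmarsh1986].
-/

noncomputable section

set_option linter.dupNamespace false

namespace Summit.RiemannHypothesis.RiemannHypothesis.Theorems.HeckeSurrogate

open Complex Filter Set MeasureTheory
open scoped Real Topology
open Literature.NumberTheory.LFunctions
open Literature.Uncategorized

/-! ## Terms of a general Dirichlet series `Σ c_k ν_k^{-s}` -/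

/-- The frequencies of a surrogate are all `≥ 1` (`ν₀ = 1`, `ν₁ = 2`, `ν_k ≥ 3`). [folklore] -/
theorem one_le_freq {ν : ℕ → ℝ} (hν0 : ν 0 = 1) (hν1 : ν 1 = 2) (hν : ∀ k : ℕ, 2 ≤ k → 3 ≤ ν k)
    (k : ℕ) : 1 ≤ ν k := by
  rcases Nat.lt_or_ge k 2 with hk | hk
  · interval_cases k
    · exact hν0.ge
    · rw [hν1]; norm_num
  · linarith [hν k hk]

/-- `‖a · x^{-s}‖ = ‖a‖ x^{-Re s}` for a positive real base `x`. [folklore] -/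
theorem norm_coeff_mul_cpow {x : ℝ} (hx : 0 < x) (a s : ℂ) :
    ‖a * ((x : ℂ) ^ (-s))‖ = ‖a‖ * x ^ (-s.re) := by
  rw [norm_mul, norm_cpow_eq_rpow_re_of_pos hx, neg_re]

/-- Domination on the closed half-plane `σ₀ ≤ Re s` for a base `x ≥ 1`:
`‖a · x^{-s}‖ ≤ ‖a‖ x^{-σ₀}`. [folklore] -/
theorem norm_coeff_mul_cpow_le {x σ₀ : ℝ} (hx : 1 ≤ x) (a : ℂ) {s : ℂ} (hs : σ₀ ≤ s.re) :
    ‖a * ((x : ℂ) ^ (-s))‖ ≤ ‖a‖ * x ^ (-σ₀) := by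
  rw [norm_coeff_mul_cpow (by linarith) a s]
  exact mul_le_mul_of_nonneg_left (Real.rpow_le_rpow_of_exponent_le hx (by linarith))
    (norm_nonneg a)

/-- Tail domination for a base `x ≥ 3` on `σ₀ ≤ Re s`:
`‖a · x^{-s}‖ ≤ 3^{σ₀} 3^{-Re s} · ‖a‖ x^{-σ₀}` (`x^{-(σ-σ₀)} ≤ 3^{-(σ-σ₀)}`). [folklore] -/
theorem norm_coeff_mul_cpow_le_three {x σ₀ : ℝ} (hx : 3 ≤ x) (a : ℂ) {s : ℂ} (hs : σ₀ ≤ s.re) :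
    ‖a * ((x : ℂ) ^ (-s))‖ ≤ (3 : ℝ) ^ σ₀ * (3 : ℝ) ^ (-s.re) * (‖a‖ * x ^ (-σ₀)) := by
  have hpos : 0 < x := by linarith
  rw [norm_coeff_mul_cpow hpos a s]
  have key : x ^ (-s.re) ≤ (3 : ℝ) ^ σ₀ * (3 : ℝ) ^ (-s.re) * x ^ (-σ₀) := by
    have e1 : x ^ (-s.re) = x ^ (-(s.re - σ₀)) * x ^ (-σ₀) := by
      rw [← Real.rpow_add hpos]; congr 1; ring
    have e2 : (3 : ℝ) ^ σ₀ * (3 : ℝ) ^ (-s.re) = (3 : ℝ) ^ (-(s.re - σ₀)) := by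
      rw [← Real.rpow_add (by norm_num : (0 : ℝ) < 3)]; congr 1; ring
    rw [e1, e2]
    exact mul_le_mul_of_nonneg_right
      (Real.rpow_le_rpow_of_nonpos (by norm_num) hx (by linarith)) (Real.rpow_nonneg hpos.le _)
  calc ‖a‖ * x ^ (-s.re) ≤ ‖a‖ * ((3 : ℝ) ^ σ₀ * (3 : ℝ) ^ (-s.re) * x ^ (-σ₀)) :=
        mul_le_mul_of_nonneg_left key (norm_nonneg a)
    _ = (3 : ℝ) ^ σ₀ * (3 : ℝ) ^ (-s.re) * (‖a‖ * x ^ (-σ₀)) := by ring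

/-- `‖2^{-s}‖ ≤ 1/4` once `Re s ≥ 2`. [folklore] -/
theorem norm_two_cpow_neg_le {s : ℂ} (hs : 2 ≤ s.re) : ‖(2 : ℂ) ^ (-s)‖ ≤ 1 / 4 := by
  have h : ‖(2 : ℂ) ^ (-s)‖ = (2 : ℝ) ^ (-s.re) := by
    rw [← ofReal_ofNat, norm_cpow_eq_rpow_re_of_pos (by norm_num), neg_re]
  rw [h]
  calc (2 : ℝ) ^ (-s.re) ≤ (2 : ℝ) ^ (-2 : ℝ) :=
        Real.rpow_le_rpow_of_exponent_le (by norm_num) (by linarith)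
    _ = 1 / 4 := by rw [Real.rpow_neg (by norm_num), Real.rpow_two]; norm_num

/-- The leading term dominates: if `L(s) = 1 + 2^{-s} + A(s)` with `Re s ≥ 2` and `‖A(s)‖ ≤ 1/4`
then `‖L(s)‖ ≥ 1/2`. [folklore] -/
theorem half_le_norm_of_split (L A : ℂ → ℂ) (s : ℂ) (hs : 2 ≤ s.re)
    (hLs : L s = 1 + 2 ^ (-s) + A s) (hAs : ‖A s‖ ≤ 1 / 4) : 1 / 2 ≤ ‖L s‖ := by
  have hu := norm_two_cpow_neg_le hs
  have h1 : (1 : ℂ) = L s - ((2 : ℂ) ^ (-s) + A s) := by rw [hLs]; ring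
  have h2 : (1 : ℝ) ≤ ‖L s‖ + (‖(2 : ℂ) ^ (-s)‖ + ‖A s‖) := by
    calc (1 : ℝ) = ‖(1 : ℂ)‖ := norm_one.symm
      _ = ‖L s - ((2 : ℂ) ^ (-s) + A s)‖ := by rw [← h1]
      _ ≤ ‖L s‖ + ‖(2 : ℂ) ^ (-s) + A s‖ := norm_sub_le _ _
      _ ≤ ‖L s‖ + (‖(2 : ℂ) ^ (-s)‖ + ‖A s‖) := by gcongr; exact norm_add_le _ _
  linarith

/-- Real parts in a closed disc: `z ∈ closedBall s r → Re s - r ≤ Re z`. [folklore] -/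
theorem sub_re_le_of_mem_closedBall {s z : ℂ} {r : ℝ} (hz : z ∈ Metric.closedBall s r) :
    s.re - r ≤ z.re := by
  rw [Metric.mem_closedBall, dist_comm, dist_eq_norm] at hz
  have h := (re_le_norm (s - z)).trans hz
  rw [sub_re] at h
  linarith

/-- The factor `s(s-1)Γ_ℝ(s)` has no zeros on `Re s > 1`. [folklore] -/
theorem polarFactor_ne_zero {z : ℂ} (hz : 1 < z.re) : z * (z - 1) * z.Gammaℝ ≠ 0 := by
  refine mul_ne_zero (mul_ne_zero ?_ ?_) (Gammaℝ_ne_zero_of_re_pos (by linarith))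
  · intro h; rw [h, zero_re] at hz; linarith
  · intro h; rw [sub_eq_zero] at h; rw [h, one_re] at hz; linarith

/-! ## The Dirichlet-series control supplied by `IsSurrogate` -/

/-- **Dirichlet control of a surrogate.** From `IsSurrogate E`: the Dirichlet series
`L(s) = Σ c_k ν_k^{-s}` is holomorphic on the open half-plane `Re s > σ₀` of absolute convergence,
`E(s) = s(s-1)Γ_ℝ(s) L(s)` there, `L = 1 + 2^{-s} + A` with the TAIL BOUND `‖A(s)‖ ≤ K · 3^{-Re s}`
(`K = 3^{σ₀} Σ_{k≥2} ‖c_k‖ ν_k^{-σ₀}`, because `ν_k ≥ 3` for `k ≥ 2`), and `‖L(s)‖ ≤ M`.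
[cite: Hecke1936, §2] -/
theorem dirichlet_control {E : ℂ → ℂ} (hE : IsSurrogate E) :
    ∃ (L A : ℂ → ℂ) (σ₀ K M : ℝ), 0 ≤ K ∧ 0 ≤ M ∧
      DifferentiableOn ℂ L {z : ℂ | σ₀ < z.re} ∧
      (∀ s : ℂ, σ₀ < s.re → E s = s * (s - 1) * s.Gammaℝ * L s) ∧
      (∀ s : ℂ, σ₀ < s.re → L s = 1 + 2 ^ (-s) + A s) ∧
      (∀ s : ℂ, σ₀ < s.re → ‖A s‖ ≤ K * (3 : ℝ) ^ (-s.re)) ∧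
      (∀ s : ℂ, σ₀ < s.re → ‖L s‖ ≤ M) := by
  obtain ⟨-, -, -, c, ν, σ₀, hc0, hν0, hc1, hν1, hν, hsum, hexp⟩ := hE
  have h1 : ∀ k, 1 ≤ ν k := one_le_freq hν0 hν1 hν
  have hsum2 : Summable (fun k => ‖c (k + 2)‖ * ν (k + 2) ^ (-σ₀)) :=
    (summable_nat_add_iff 2).2 hsum
  have hS0 : 0 ≤ ∑' k, ‖c (k + 2)‖ * ν (k + 2) ^ (-σ₀) :=
    tsum_nonneg fun k => mul_nonneg (norm_nonneg _) (Real.rpow_nonneg (by linarith [h1 (k + 2)]) _)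
  have hM0 : 0 ≤ ∑' k, ‖c k‖ * ν k ^ (-σ₀) :=
    tsum_nonneg fun k => mul_nonneg (norm_nonneg _) (Real.rpow_nonneg (by linarith [h1 k]) _)
  refine ⟨fun s => ∑' k, c k * ((ν k : ℂ) ^ (-s)),
    fun s => ∑' k, c (k + 2) * ((ν (k + 2) : ℂ) ^ (-s)), σ₀,
    (3 : ℝ) ^ σ₀ * ∑' k, ‖c (k + 2)‖ * ν (k + 2) ^ (-σ₀), ∑' k, ‖c k‖ * ν k ^ (-σ₀),
    mul_nonneg (Real.rpow_nonneg (by norm_num) _) hS0, hM0, ?_, hexp,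
    fun s hs => ?_, fun s hs => ?_, fun s hs => ?_⟩
  · -- holomorphy: Weierstrass M-test + locally uniform limits of holomorphic functions
    refine differentiableOn_tsum_of_summable_norm hsum (fun k => ?_)
      (isOpen_lt continuous_const continuous_re)
      (fun k w hw => norm_coeff_mul_cpow_le (h1 k) (c k) (show σ₀ < w.re from hw).le)
    have hk : (ν k : ℂ) ≠ 0 := ofReal_ne_zero.2 (by linarith [h1 k])
    exact ((differentiable_neg.const_cpow (Or.inl hk)).const_mul (c k)).differentiableOn
  · -- split off the two leading terms `c₀ ν₀^{-s} = 1`, `c₁ ν₁^{-s} = 2^{-s}`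
    have hs' : Summable (fun k => c k * ((ν k : ℂ) ^ (-s))) :=
      Summable.of_norm_bounded hsum (fun k => norm_coeff_mul_cpow_le (h1 k) (c k) hs.le)
    show (∑' k, c k * ((ν k : ℂ) ^ (-s))) =
      1 + 2 ^ (-s) + ∑' k, c (k + 2) * ((ν (k + 2) : ℂ) ^ (-s))
    rw [← hs'.sum_add_tsum_nat_add 2]
    simp only [Finset.sum_range_succ, Finset.sum_range_zero, zero_add, hc0, hc1, hν0, hν1,
      ofReal_one, one_cpow, ofReal_ofNat, one_mul]
  · -- the tail bound
    show ‖∑' k, c (k + 2) * ((ν (k + 2) : ℂ) ^ (-s))‖ ≤ _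
    calc ‖∑' k, c (k + 2) * ((ν (k + 2) : ℂ) ^ (-s))‖
        ≤ (3 : ℝ) ^ σ₀ * (3 : ℝ) ^ (-s.re) * ∑' k, ‖c (k + 2)‖ * ν (k + 2) ^ (-σ₀) :=
          tsum_of_norm_bounded (hsum2.hasSum.mul_left _)
            (fun k => norm_coeff_mul_cpow_le_three (hν (k + 2) (by omega)) (c (k + 2)) hs.le)
      _ = (3 : ℝ) ^ σ₀ * (∑' k, ‖c (k + 2)‖ * ν (k + 2) ^ (-σ₀)) * (3 : ℝ) ^ (-s.re) := by ring
  · -- the global bound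
    exact tsum_of_norm_bounded hsum.hasSum (fun k => norm_coeff_mul_cpow_le (h1 k) (c k) hs.le)

/-! ## The registered stub -/

/-- **`stub_logDerivDiff`** (registered stub A of the line `hecke-cusp-perturbation-surrogate`, crux
stmt-RiemannHypothesis-11196): every surrogate `E` is controlled on a right half-plane —
`‖s(s-1)Γ_ℝ(s)‖ ≤ 2‖E(s)‖` and `‖E'/E(s) - ξ₂'/ξ₂(s)‖ ≤ C · 3^{-Re s}` for `Re s ≥ σ₁`. The
frequency-`1` and `2` terms of the two Dirichlet series cancel in `L_E'/L_E - L_ξ'/L_ξ`, and the tails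
are `O(3^{-σ})` (derivatives by Cauchy's estimate on the unit circle). [cite: Hecke1936, §2] -/
theorem stub_logDerivDiff : ∀ E : ℂ → ℂ, IsSurrogate E → RightHalfPlaneControl E := by
  intro E hE
  have hEd : Differentiable ℂ E := hE.1
  have hXd : Differentiable ℂ xi2 := differentiable_xi2
  obtain ⟨L₁, A₁, σa, K₁, M₁, hK₁, _, hL₁d, hE₁, hsplit₁, hA₁, _⟩ := dirichlet_control hE
  obtain ⟨L₂, A₂, σb, K₂, M₂, hK₂, hM₂, hL₂d, hE₂, hsplit₂, hA₂, hbd₂⟩ :=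
    dirichlet_control stub_xi2Surrogate
  obtain ⟨σs, hσa, hσb, hσ1⟩ : ∃ σs : ℝ, σa ≤ σs ∧ σb ≤ σs ∧ 1 ≤ σs :=
    ⟨max (max σa σb) 1, le_trans (le_max_left _ _) (le_max_left _ _),
      le_trans (le_max_right _ _) (le_max_left _ _), le_max_right _ _⟩
  obtain ⟨K, hK0, hK⟩ : ∃ K : ℝ, 0 ≤ K ∧ K = K₁ + K₂ := ⟨_, add_nonneg hK₁ hK₂, rfl⟩
  obtain ⟨t, ht0, ht⟩ : ∃ t : ℝ, 0 ≤ t ∧ K * (3 : ℝ) ^ (-t) ≤ 1 / 4 := by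
    refine ⟨Real.logb 3 (4 * K + 1), Real.logb_nonneg (by norm_num) (by linarith), ?_⟩
    rw [Real.rpow_neg (by norm_num), Real.rpow_logb (by norm_num) (by norm_num) (by linarith),
      ← div_eq_mul_inv, div_le_div_iff₀ (by linarith) (by norm_num : (0 : ℝ) < 4)]
    linarith
  have hU : IsOpen {z : ℂ | σs < z.re} := isOpen_lt continuous_const continuous_re
  have hL₁U : DifferentiableOn ℂ L₁ {z : ℂ | σs < z.re} :=
    hL₁d.mono fun z hz => lt_of_le_of_lt hσa hz
  have hL₂U : DifferentiableOn ℂ L₂ {z : ℂ | σs < z.re} :=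
    hL₂d.mono fun z hz => lt_of_le_of_lt hσb hz
  -- the difference of the two Dirichlet series is a difference of TAILS (frequencies ≥ 3)
  have hD_bound : ∀ z : ℂ, σs < z.re → ‖L₁ z - L₂ z‖ ≤ K * (3 : ℝ) ^ (-z.re) := by
    intro z hz
    rw [hsplit₁ z (by linarith), hsplit₂ z (by linarith), add_sub_add_left_eq_sub, hK]
    calc ‖A₁ z - A₂ z‖ ≤ ‖A₁ z‖ + ‖A₂ z‖ := norm_sub_le _ _
      _ ≤ K₁ * (3 : ℝ) ^ (-z.re) + K₂ * (3 : ℝ) ^ (-z.re) :=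
          add_le_add (hA₁ z (by linarith)) (hA₂ z (by linarith))
      _ = (K₁ + K₂) * (3 : ℝ) ^ (-z.re) := by ring
  -- common consequences of `σ₁ ≤ Re s`
  have common : ∀ s : ℂ, σs + 2 + t ≤ s.re →
      σa < s.re ∧ σb < s.re ∧ 1 / 2 ≤ ‖L₁ s‖ ∧ 1 / 2 ≤ ‖L₂ s‖ := by
    intro s hs
    have hsa : σa < s.re := by linarith
    have hsb : σb < s.re := by linarith
    have h3 : 0 ≤ (3 : ℝ) ^ (-s.re) := Real.rpow_nonneg (by norm_num) _
    have hKs : K * (3 : ℝ) ^ (-s.re) ≤ 1 / 4 :=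
      (mul_le_mul_of_nonneg_left
        (Real.rpow_le_rpow_of_exponent_le (by norm_num) (by linarith)) hK0).trans ht
    have hK₁3 : 0 ≤ K₁ * (3 : ℝ) ^ (-s.re) := mul_nonneg hK₁ h3
    have hK₂3 : 0 ≤ K₂ * (3 : ℝ) ^ (-s.re) := mul_nonneg hK₂ h3
    have hKe : K * (3 : ℝ) ^ (-s.re) = K₁ * (3 : ℝ) ^ (-s.re) + K₂ * (3 : ℝ) ^ (-s.re) := by
      rw [hK]; ring
    have hA₁s : ‖A₁ s‖ ≤ 1 / 4 := by linarith [hA₁ s hsa]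
    have hA₂s : ‖A₂ s‖ ≤ 1 / 4 := by linarith [hA₂ s hsb]
    exact ⟨hsa, hsb, half_le_norm_of_split L₁ A₁ s (by linarith) (hsplit₁ s hsa) hA₁s,
      half_le_norm_of_split L₂ A₂ s (by linarith) (hsplit₂ s hsb) hA₂s⟩
  refine ⟨σs + 2 + t, (6 + 4 * M₂) * K, by linarith, mul_nonneg (by linarith) hK0,
    fun s hs => ?_, fun s hs => ?_⟩
  · -- (i) the leading term dominates
    obtain ⟨hsa, -, hL₁s, -⟩ := common s hs
    rw [hE₁ s hsa, norm_mul (s * (s - 1) * s.Gammaℝ) (L₁ s)]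
    calc ‖s * (s - 1) * s.Gammaℝ‖ = 2 * (‖s * (s - 1) * s.Gammaℝ‖ * (1 / 2)) := by ring
      _ ≤ 2 * (‖s * (s - 1) * s.Gammaℝ‖ * ‖L₁ s‖) := by gcongr
  · -- (ii) the relative logarithmic derivative
    obtain ⟨hsa, hsb, hL₁s, hL₂s⟩ := common s hs
    have hss : σs < s.re := by linarith
    have hmem : {z : ℂ | σs < z.re} ∈ 𝓝 s := hU.mem_nhds hss
    have hL₁ne : L₁ s ≠ 0 := fun h => by rw [h, norm_zero] at hL₁s; linarith
    have hL₂ne : L₂ s ≠ 0 := fun h => by rw [h, norm_zero] at hL₂s; linarith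
    have hPs : s * (s - 1) * s.Gammaℝ ≠ 0 := polarFactor_ne_zero (by linarith)
    have hEne : E s ≠ 0 := by rw [hE₁ s hsa]; exact mul_ne_zero hPs hL₁ne
    have hXne : xi2 s ≠ 0 := by rw [hE₂ s hsb]; exact mul_ne_zero hPs hL₂ne
    have hL₁da : DifferentiableAt ℂ L₁ s := hL₁U.differentiableAt hmem
    have hL₂da : DifferentiableAt ℂ L₂ s := hL₂U.differentiableAt hmem
    -- Step 1: `E/ξ₂ = L_E/L_ξ` near `s`, so the relative log-derivatives agree
    have hquot : (fun z => E z / xi2 z) =ᶠ[𝓝 s] (fun z => L₁ z / L₂ z) := by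
      filter_upwards [hmem] with z hz
      have hz' : σs < z.re := hz
      rw [hE₁ z (by linarith), hE₂ z (by linarith),
        mul_div_mul_left _ _ (polarFactor_ne_zero (by linarith))]
    have hq : logDeriv (fun z => E z / xi2 z) s = logDeriv (fun z => L₁ z / L₂ z) s := by
      simp only [logDeriv_apply, hquot.deriv_eq, hquot.eq_of_nhds]
    have hld : logDeriv E s - logDeriv xi2 s = logDeriv L₁ s - logDeriv L₂ s := by
      rw [← logDeriv_div s hEne hXne (hEd s) (hXd s), hq, logDeriv_div s hL₁ne hL₂ne hL₁da hL₂da]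
    -- Step 2: Cauchy estimates on the unit circle around `s`
    have hball : Metric.closedBall s 1 ⊆ {z : ℂ | σs < z.re} := fun z hz => by
      have := sub_re_le_of_mem_closedBall hz
      show σs < z.re
      linarith
    have hDd : ‖deriv (fun z => L₁ z - L₂ z) s‖ ≤ 3 * K * (3 : ℝ) ^ (-s.re) := by
      have h := norm_deriv_le_of_forall_mem_sphere_norm_le (f := fun z => L₁ z - L₂ z)
        (C := 3 * K * (3 : ℝ) ^ (-s.re)) zero_lt_one ((hL₁U.sub hL₂U).diffContOnCl_ball hball)
        (fun z hz => ?_)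
      · simpa using h
      · have hzre := sub_re_le_of_mem_closedBall (Metric.sphere_subset_closedBall hz)
        have hz' : σs < z.re := by linarith
        calc ‖L₁ z - L₂ z‖ ≤ K * (3 : ℝ) ^ (-z.re) := hD_bound z hz'
          _ ≤ K * ((3 : ℝ) ^ (-(s.re - 1))) :=
              mul_le_mul_of_nonneg_left
                (Real.rpow_le_rpow_of_exponent_le (by norm_num) (by linarith)) hK0
          _ = 3 * K * (3 : ℝ) ^ (-s.re) := by
              rw [neg_sub, Real.rpow_sub (by norm_num), Real.rpow_one,
                Real.rpow_neg (by norm_num)]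
              ring
    have hL₂' : ‖deriv L₂ s‖ ≤ M₂ := by
      have h := norm_deriv_le_of_forall_mem_sphere_norm_le (f := L₂) (C := M₂) zero_lt_one
        (hL₂U.diffContOnCl_ball hball) (fun z hz => hbd₂ z ?_)
      · simpa using h
      · have hzre := sub_re_le_of_mem_closedBall (Metric.sphere_subset_closedBall hz)
        linarith
    -- Step 3: `L_E'/L_E - L_ξ'/L_ξ = D'/L_E + L_ξ' (L_ξ - L_E)/(L_E L_ξ)`
    rw [hld, logDeriv_apply, logDeriv_apply]
    have halg : deriv L₁ s / L₁ s - deriv L₂ s / L₂ s =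
        (deriv L₁ s - deriv L₂ s) / L₁ s + deriv L₂ s * (L₂ s - L₁ s) / (L₁ s * L₂ s) := by
      field_simp
      ring
    rw [halg]
    have hnum1 : ‖deriv L₁ s - deriv L₂ s‖ ≤ 3 * K * (3 : ℝ) ^ (-s.re) := by
      rw [← deriv_fun_sub hL₁da hL₂da]; exact hDd
    have hDs : ‖L₂ s - L₁ s‖ ≤ K * (3 : ℝ) ^ (-s.re) := by
      rw [norm_sub_rev]; exact hD_bound s hss
    have h3 : 0 ≤ (3 : ℝ) ^ (-s.re) := Real.rpow_nonneg (by norm_num) _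
    calc ‖(deriv L₁ s - deriv L₂ s) / L₁ s + deriv L₂ s * (L₂ s - L₁ s) / (L₁ s * L₂ s)‖
        ≤ ‖deriv L₁ s - deriv L₂ s‖ / ‖L₁ s‖
            + ‖deriv L₂ s‖ * ‖L₂ s - L₁ s‖ / (‖L₁ s‖ * ‖L₂ s‖) := by
          refine (norm_add_le _ _).trans_eq ?_
          rw [norm_div, norm_div, norm_mul, norm_mul]
      _ ≤ 3 * K * (3 : ℝ) ^ (-s.re) / (1 / 2)
            + M₂ * (K * (3 : ℝ) ^ (-s.re)) / (1 / 2 * (1 / 2)) := by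
          refine add_le_add
            (div_le_div₀ (mul_nonneg (mul_nonneg (by norm_num) hK0) h3) hnum1 (by norm_num) hL₁s)
            (div_le_div₀ (mul_nonneg hM₂ (mul_nonneg hK0 h3)) ?_ (by norm_num) ?_)
          · exact mul_le_mul hL₂' hDs (norm_nonneg _) hM₂
          · exact mul_le_mul hL₁s hL₂s (by norm_num) (norm_nonneg _)
      _ = (6 + 4 * M₂) * K * (3 : ℝ) ^ (-s.re) := by ring

end Summit.RiemannHypothesis.RiemannHypothesis.Theorems.HeckeSurrogate

end
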